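import Summits.NavierStokesRegularity.NavierStokesRegularity.Theorems.ScenarioCensusRowF1OneLevelTopZoom
import Summits.NavierStokesRegularity.NavierStokesRegularity.Theorems.ScenarioCensusRowF1TwoTimeTopRows
import HarnessLib

/-!
# LINE 35 «one-level-top» port, part 3/3: §5 the ONE-LEVEL ROW proved (`rowF1lv_holds`), the definite level `gapLevel M θ`, floor `OneLevelFloor`, residual `LevelCollapse` ≡ `Row_F1`,
# order theorems (LINE 34's `rowF1dj_holds` BY NAME; here it is the corollary `rowF1dj_of_rowF1lv rowF1lv_holds`); §6 SECOND SOCKET INSTANCE — translate-disjoint tops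
# (`Row_F1td`, `rowF1td_holds`); §7 sharpness and order remarks; census KEYS `Row_F1lv` / `Row_F1td` + `_excluded`, floor OLF, edge F1lv ⇒ F1dj

Re-homed for the scenario census (typer seat ns-census-typer-1 g9; the cells F1lv / F1td and the floor OLF are MEMBERS OF RECORD «DECIDED IN KERNEL IN FILES» of row F1 since
census v1.101 (item 73: critic PASS; ref ns-census-ref g13 PRE-CHECK ✓ §18.9; lead-presearch label); this port makes them TREE-decided): VERBATIM PORT of ns-idea-3
LINE 35 «one-level-top», `pub/ideators/ns-idea-3/lines/one-level-top/line-one-level-top.lean` sha16 06846e90c67bb04b (874 l., lean check rc 0, 0 sorry), split for the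
400-line rule into `ScenarioCensusRowF1OneLevelTop` (§1–§3) → `…OneLevelTopZoom` (§4) → `…OneLevelTopRows` (§5–§7 + census KEYS).  Lean text VERBATIM in namespace
`…Theorems.ScenarioCensus.OneLevelTop` (the line's `…Cruxes.ScenarioCensusRowF1.OneLevelTopLine` re-homed); port edits: LINE 34's VERBATIM restatements (`lagTime`, `topSet`,
`HasDisjointTops`, `Row_F1dj`, the signal lemmas, `rowF1dj_holds`) and LINE 15's `tendsto_physicalTime` are taken BY NAME from the landed two-time-top / columnar-top ports
(`TwoTimeTop.…`, `ColumnarTop.…`); `@[conjecture]` on the residual `LevelCollapse` (≡ `ScenarioCensus.Row_F1`, OPEN); six one-line docstrings added (gate lint).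
Statements untouched.

No census VALUE is moved here (row F1 stays OPEN-WITH-LINE; the members become TREE-decided by name); NS regularity is NOT proved; `Row_F1` is untouched (zero
movement, `levelCollapse_iff_rowF1`); no summit statement is proved by this file. Lemmas that restate already-landed tree declarations are taken BY NAME (gate lint `dedup.landed`): `rowF1dj_holds` = `TwoTimeTop.rowF1dj_holds`, `tendsto_physicalTime` = `ColumnarTop.tendsto_physicalTime`.
-/

-- the summit and its single problem share the name `NavierStokesRegularity` (D-0017 nested layout)
set_option linter.dupNamespace false

noncomputable section

open MeasureTheory Set Function Filter TopologicalSpace Metric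
open scoped Topology NNReal ENNReal

namespace Summit.NavierStokesRegularity.NavierStokesRegularity.Theorems.ScenarioCensus.OneLevelTop

open Literature.Analysis Literature.Analysis.FluidPDE
open Summit.NavierStokesRegularity.NavierStokesRegularity.Theorems
open Summit.NavierStokesRegularity.NavierStokesRegularity.Theses

/-! ## §5 The ONE-LEVEL ROW, proved; the definite level `gapLevel M θ`; floor; residual ≡ row F1; order theorems -/

/-- **Top bookkeeping at a moving centre.**  If the zoomed speed `c|u(T + c²νt, x)|` exceeds `Λ₁/2` at a rescaled time
`t ≤ −1`, the physical point `x` is on the top of level `Λ₁/4` at the physical time `T + c²νt`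
(`√(T − (T + c²νt)) = c√ν√(−t) ≥ c√ν`). -/
theorem mem_topSet_of_zoom {ν T Λ₁ c t : ℝ} {u : ℝ → E3 → E3} {x : E3} (hν : 0 < ν) (hc : 0 < c) (hΛ : 0 < Λ₁)
    (ht : t ≤ -1) (h : Λ₁ / 2 < c * ‖u (T + c ^ 2 * ν * t) x‖) :
    x ∈ TwoTimeTop.topSet ν T u (Λ₁ / 4) (T + c ^ 2 * ν * t) := by
  rw [TwoTimeTop.mem_topSet]
  have hsq : Real.sqrt (T - (T + c ^ 2 * ν * t)) = c * Real.sqrt ν * Real.sqrt (-t) := by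
    have e : T - (T + c ^ 2 * ν * t) = (c ^ 2 * ν) * (-t) := by ring
    rw [e, Real.sqrt_mul (by positivity), Real.sqrt_mul (sq_nonneg _), Real.sqrt_sq hc.le]
  rw [hsq]
  have h1 : 1 ≤ Real.sqrt (-t) := by
    rw [show (1 : ℝ) = Real.sqrt 1 by rw [Real.sqrt_one]]
    exact Real.sqrt_le_sqrt (by linarith)
  have hsν : 0 ≤ Real.sqrt ν := Real.sqrt_nonneg ν
  have hcu : 0 ≤ c * ‖u (T + c ^ 2 * ν * t) x‖ := by positivity
  calc Λ₁ / 4 * Real.sqrt ν ≤ Λ₁ / 2 * Real.sqrt ν * 1 := by nlinarith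
    _ ≤ c * ‖u (T + c ^ 2 * ν * t) x‖ * Real.sqrt ν * Real.sqrt (-t) :=
        mul_le_mul (mul_le_mul_of_nonneg_right h.le hsν) h1 zero_le_one (by positivity)
    _ = c * Real.sqrt ν * Real.sqrt (-t) * ‖u (T + c ^ 2 * ν * t) x‖ := by ring

/-- The zoomed speed at the moving centre eventually exceeds `Λ₁/2` when the limit speed is at least `Λ₁ > 0`. -/
theorem eventually_fast_of_tendsto {T ν Λ₁ s : ℝ} {u : ℝ → E3 → E3} {c : ℕ → ℝ} {x : ℕ → E3} {L : E3}
    (hcpos : ∀ j, 0 < c j) (hΛ : 0 < Λ₁)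
    (hpt : Tendsto (fun j => (c j * 1) • u (T + c j ^ 2 * ν * s) (x j + (c j * ν) • (0 : E3))) atTop (𝓝 L))
    (hL : Λ₁ ≤ ‖L‖) : ∀ᶠ j in atTop, Λ₁ / 2 < c j * ‖u (T + c j ^ 2 * ν * s) (x j)‖ := by
  have hl := (hpt.norm).eventually_const_lt (show Λ₁ / 2 < ‖L‖ by linarith)
  filter_upwards [hl] with j hj
  rwa [smul_zero, add_zero, mul_one, norm_smul, Real.norm_eq_abs, abs_of_pos (hcpos j)] at hj

/-- **Criterion row F1lv is EXCLUDED** (in kernel).  Proof: the DJ level `Λ₁(M, θ, c_L)` of §3 and `Λ₀ := Λ₁/4`; a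
non-extending solution has a normalised moving-centre zoom limit `W ∈ 𝒦_M` (§4), which is `Λ₁`-fast at `0` at two instants
`t, (1+θ)t` of the window; pulled back, the centre `x_j` is on BOTH tops of level `Λ₁/4` at the physical time `T + c_j²νt ↑ T`
and its lagged time — contradicting one-level disjointness. -/
theorem rowF1lv_holds : Row_F1lv := by
  intro θ M hθ
  obtain ⟨Λ₁, hΛ₁, hkey⟩ := exists_disjointLevel M θ hθ lerayLevel_pos
  refine ⟨Λ₁ / 4, by positivity, ?_⟩
  intro ν T hν hT u p hsol hLH hdec hM hdisj
  by_contra hmax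
  obtain ⟨c, x, W, hcpos, hclim, hW, hpt, hnorm⟩ :=
    exists_normalisedZoom_package hν hT hsol hLH hdec hM hmax
  obtain ⟨t, ht, h1, h2⟩ := hkey W hW hnorm
  have hκ : 0 < 1 + θ := by linarith
  have ht0 : t < 0 := by linarith [ht.2]
  have ht1 : t ≤ -1 := ht.2.le
  have ht1' : (1 + θ) * t ≤ -1 := by nlinarith [ht.2]
  have ht0' : (1 + θ) * t < 0 := by linarith
  -- eventually the zoomed speeds at the moving centre exceed `Λ₁/2` at `t` and at `(1+θ)t`
  have hev1 : ∀ᶠ j in atTop, Λ₁ / 2 < c j * ‖u (T + c j ^ 2 * ν * t) (x j)‖ :=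
    eventually_fast_of_tendsto hcpos hΛ₁ (hpt t ht0 0) h2
  have hev2 : ∀ᶠ j in atTop, Λ₁ / 2 < c j * ‖u (T + c j ^ 2 * ν * ((1 + θ) * t)) (x j)‖ :=
    eventually_fast_of_tendsto hcpos hΛ₁ (hpt ((1 + θ) * t) ht0' 0) h1
  -- the physical times `τ_j = T + c_j² ν t ↑ T`: one-level disjointness holds there, eventually
  have hτ : Tendsto (fun j => T + c j ^ 2 * ν * t) atTop (𝓝[<] T) := ColumnarTop.tendsto_physicalTime hν ht0 hcpos hclim
  have hev3 := hτ.eventually hdisj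
  obtain ⟨j, hj1, hj2, hj3⟩ := (hev1.and (hev2.and hev3)).exists
  have hm1 : x j ∈ TwoTimeTop.topSet ν T u (Λ₁ / 4) (T + c j ^ 2 * ν * t) := mem_topSet_of_zoom hν (hcpos j) hΛ₁ ht1 hj1
  have hm2 : x j ∈ TwoTimeTop.topSet ν T u (Λ₁ / 4) (TwoTimeTop.lagTime T θ (T + c j ^ 2 * ν * t)) := by
    rw [TwoTimeTop.lagTime_zoom]
    exact mem_topSet_of_zoom hν (hcpos j) hΛ₁ ht1' hj2
  exact Set.disjoint_left.1 hj3 hm2 hm1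

-- `rowF1dj_holds`: the line restates the tree's `TwoTimeTop.rowF1dj_holds`; taken BY NAME (gate lint dedup.landed).

/-- **The definite level `Λ₀(M, θ)`** of the one-level row (a choice of the level provided by `rowF1lv_holds`; `1` for
`θ ≤ 0`, where nothing is claimed).  Ineffective. -/
def gapLevel (M θ : ℝ) : ℝ := if hθ : 0 < θ then Classical.choose (rowF1lv_holds θ M hθ) else 1

/-- The definite level is positive. -/
theorem gapLevel_pos (M θ : ℝ) : 0 < gapLevel M θ := by
  unfold gapLevel
  split_ifs with hθ
  · exact (Classical.choose_spec (rowF1lv_holds θ M hθ)).1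
  · exact one_pos

/-- **Row F1lv at the named level**: Type I with constant `M` + disjoint tops of level `gapLevel M θ` with lag `θ` ⇒ extension. -/
theorem gapLevel_spec {θ : ℝ} (M : ℝ) (hθ : 0 < θ) :
    ∀ (ν T : ℝ), 0 < ν → 0 < T → ∀ (u : ℝ → E3 → E3) (p : ℝ → E3 → ℝ),
    IsClassicalNSSolutionOn (Ico 0 T) ν 0 u p → IsLerayHopfOn T ν 0 (u 0) u →
    HasRapidSpatialDecay (u 0) → HasTypeIConstant ν T M u → HasDisjointTopsAt ν T θ (gapLevel M θ) u →
    HasSmoothExtensionPast ν 0 u T := by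
  have e : gapLevel M θ = Classical.choose (rowF1lv_holds θ M hθ) := by
    unfold gapLevel; rw [dif_pos hθ]
  rw [e]
  exact (Classical.choose_spec (rowF1lv_holds θ M hθ)).2

/-- **ONE-LEVEL FLOOR** (structural, maximal frame): at a maximal Type-I Clay blow-up with dimensionless constant `M`, for
every lag `θ > 0`, at times arbitrarily close to `T` SOME point is `Λ₀(M, θ)`-fast BOTH now and one lag earlier — persistent
fast points at a DEFINITE level (LINE 34's floor `PersistentTops` only gave persistence at SOME level).  PROVED. -/
def OneLevelFloor : Prop :=
  ∀ (ν T : ℝ), 0 < ν → 0 < T → ∀ (u : ℝ → E3 → E3) (p : ℝ → E3 → ℝ),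
    IsMaximalSmoothSolution ν 0 u p T → IsLerayHopfOn T ν 0 (u 0) u → HasRapidSpatialDecay (u 0) →
    ∀ M θ : ℝ, HasTypeIConstant ν T M u → 0 < θ →
      ∃ᶠ t in 𝓝[<] T, ∃ x : E3,
        x ∈ TwoTimeTop.topSet ν T u (gapLevel M θ) (TwoTimeTop.lagTime T θ t) ∧ x ∈ TwoTimeTop.topSet ν T u (gapLevel M θ) t

/-- **The ONE-LEVEL FLOOR holds.** -/
theorem oneLevelFloor_holds : OneLevelFloor := by
  intro ν T hν hT u p hmax hLH hdec M θ hM hθ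
  by_contra hno
  rw [Filter.not_frequently] at hno
  apply hmax.2 (gapLevel_spec M hθ ν T hν hT u p hmax.1 hLH hdec hM ?_)
  filter_upwards [hno] with t ht
  exact Set.disjoint_left.2 fun x hx1 hx2 => ht ⟨x, hx1, hx2⟩

/-- **Residual at the definite level** (maximal frame): every maximal Type-I Clay blow-up with constant `M` has, for some
lag `θ > 0`, disjoint tops AT THE LEVEL `gapLevel M θ`.  DECLARED ≡ row F1 (`levelCollapse_iff_rowF1`); no movement on
`Row_F1` is claimed. -/
@[conjecture] def LevelCollapse : Prop :=
  ∀ (ν T : ℝ), 0 < ν → 0 < T → ∀ (u : ℝ → E3 → E3) (p : ℝ → E3 → ℝ),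
    IsMaximalSmoothSolution ν 0 u p T → IsLerayHopfOn T ν 0 (u 0) u → HasRapidSpatialDecay (u 0) →
    ∀ M : ℝ, HasTypeIConstant ν T M u → ∃ θ : ℝ, 0 < θ ∧ HasDisjointTopsAt ν T θ (gapLevel M θ) u

/-- **The split**: one-level row (proved) + residual ⇒ row F1. -/
theorem rowF1_of_levelCollapse (hR : LevelCollapse) : ScenarioCensus.Row_F1 := by
  unfold ScenarioCensus.Row_F1
  intro ν T hν hT u p hsol hLH hdec hTI
  by_contra hext
  obtain ⟨M, hM⟩ := exists_hasTypeIConstant hν hTI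
  obtain ⟨θ, hθ, hdisj⟩ := hR ν T hν hT u p ⟨hsol, hext⟩ hLH hdec M hM
  exact hext (gapLevel_spec M hθ ν T hν hT u p hsol hLH hdec hM hdisj)

/-- The residual is a consequence of row F1 (vacuously). -/
theorem levelCollapse_of_rowF1 (h : ScenarioCensus.Row_F1) : LevelCollapse :=
  fun ν T hν hT u p hmax hLH hdec _ hM =>
    (hmax.2 (h ν T hν hT u p hmax.1 hLH hdec hM.isTypeIBlowup)).elim

/-- The residual `LevelCollapse` is EXACTLY `Row_F1`. -/
theorem levelCollapse_iff_rowF1 : LevelCollapse ↔ ScenarioCensus.Row_F1 :=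
  ⟨rowF1_of_levelCollapse, levelCollapse_of_rowF1⟩

/-! ## §6 SECOND SOCKET INSTANCE — TRANSLATE-DISJOINT tops (a SPACE-local exact kill: slice analyticity)

The socket is not tied to the two-time read-out.  Here the exact kill is local in SPACE: the top of ONE level never contains
two points at the fixed parabolic separation `√(ν(T − t))·d` (`d` a fixed vector; `d = 0` is Leray's floor itself).  Under the
moving-centre zoom the separation becomes `√(−t)·d`; the limit kill is the identity theorem for the real-analytic slices
`W(t, ·)` (tree `IsTypeIAncientMild.analyticOnNhd_slice_univ`), followed by time rigidity at the centre. -/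

/-- **(TD at ONE level)**: eventually, no two `Λ`-fast points at the parabolic separation `√(ν(T − t))·d`. -/
def HasTranslateDisjointTopsAt (ν T : ℝ) (d : E3) (Λ : ℝ) (u : ℝ → E3 → E3) : Prop :=
  ∀ᶠ t in 𝓝[<] T, ∀ x ∈ TwoTimeTop.topSet ν T u Λ t, x + Real.sqrt (ν * (T - t)) • d ∉ TwoTimeTop.topSet ν T u Λ t

/-- **Criterion row F1td — ONE-LEVEL TRANSLATE-DISJOINT TOPS** (Type I with dimensionless constant `M` · eventually no two
`Λ₀`-fast points at separation `√(ν(T − t))·d`, ONE level `Λ₀ = Λ₀(M, d)` · Clay ⇒ extension).  PROVED (`rowF1td_holds`). -/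
def Row_F1td : Prop :=
  ∀ (d : E3) (M : ℝ), ∃ Λ₀ : ℝ, 0 < Λ₀ ∧
    ∀ (ν T : ℝ), 0 < ν → 0 < T → ∀ (u : ℝ → E3 → E3) (p : ℝ → E3 → ℝ),
    IsClassicalNSSolutionOn (Ico 0 T) ν 0 u p → IsLerayHopfOn T ν 0 (u 0) u →
    HasRapidSpatialDecay (u 0) → HasTypeIConstant ν T M u → HasTranslateDisjointTopsAt ν T d Λ₀ u →
    HasSmoothExtensionPast ν 0 u T

/-- **WINDOWED KILL (TD).**  If on a time window `(a, b)`, `a < b ≤ 0`, every point `y` of a ball about `0` has `W(t, y) = 0` or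
`W(t, y + s(t)) = 0` (any shift `s(t)`), then `W(·, 0) ≡ 0` on the open past: a slice nonzero at `0` is nonzero near `0`, so it
vanishes near `s(t)`, so it vanishes identically (identity theorem for the analytic slice) — contradiction; then time rigidity. -/
theorem signal_eq_zero_of_translate_window {M : ℝ} {W : ℝ → E3 → E3} (hW : IsTypeIAncientMild M W)
    {a b r : ℝ} (hab : a < b) (hb : b ≤ 0) (hr : 0 < r) (s : ℝ → E3)
    (h : ∀ t ∈ Ioo a b, ∀ y ∈ ball (0 : E3) r, W t y = 0 ∨ W t (y + s t) = 0) : ∀ t < 0, W t 0 = 0 := by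
  have hwin : ∀ t ∈ Ioo a b, W t 0 = 0 := by
    intro t htI
    have ht0 : t < 0 := lt_of_lt_of_le htI.2 hb
    have han : AnalyticOnNhd ℝ (W t) univ := hW.analyticOnNhd_slice_univ ht0
    by_contra hne
    have hc : ContinuousAt (W t) 0 := (han 0 (mem_univ _)).continuousAt
    have hev1 : ∀ᶠ y in 𝓝 (0 : E3), W t y ≠ 0 := hc.eventually_ne hne
    have hev2 : ∀ᶠ y in 𝓝 (0 : E3), y ∈ ball (0 : E3) r := ball_mem_nhds 0 hr
    have hzero : ∀ᶠ y in 𝓝 (0 : E3), W t (y + s t) = 0 := by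
      filter_upwards [hev1, hev2] with y hy hyB
      exact (h t htI y hyB).resolve_left hy
    -- transport to a neighbourhood of `s t`
    have hg : Tendsto (fun z : E3 => z - s t) (𝓝 (s t)) (𝓝 0) := by
      have h1 : Tendsto (fun z : E3 => z - s t) (𝓝 (s t)) (𝓝 (s t - s t)) :=
        (continuous_id.sub continuous_const).tendsto (s t)
      rwa [sub_self] at h1
    have hz : ∀ᶠ z in 𝓝 (s t), W t z = 0 := by
      filter_upwards [hg.eventually hzero] with z hz
      simpa using hz
    have hEq : EqOn (W t) 0 univ :=
      han.eqOn_zero_of_preconnected_of_eventuallyEq_zero isPreconnected_univ (mem_univ (s t)) hz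
    exact hne (by simpa using hEq (mem_univ (0 : E3)))
  set t₀ : ℝ := (a + b) / 2 with ht₀
  have ht₀a : a < t₀ := by rw [ht₀]; linarith
  have ht₀b : t₀ < b := by rw [ht₀]; linarith
  have ht₀0 : t₀ < 0 := by linarith
  have hev : ∀ᶠ σ in 𝓝 t₀, W (1 * σ) 0 = 0 := by
    filter_upwards [Ioo_mem_nhds ht₀a ht₀b] with σ hσ
    rw [one_mul]
    exact hwin σ hσ
  exact TwoTimeTop.signal_eq_zero_of_eventually hW 0 one_pos ht₀0 hev

/-- The **TD defect below `Λ`** (window `(−2, −1) × B(0, 1)`): every point of the ball is slower than `Λ` or its translate by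
`√(−t)·d` is. -/
def TranslateDefectBelow (d : E3) (Λ : ℝ) (W : ℝ → E3 → E3) : Prop :=
  ∀ t ∈ Ioo (-2 : ℝ) (-1), ∀ y ∈ ball (0 : E3) 1, ‖W t y‖ < Λ ∨ ‖W t (y + Real.sqrt (-t) • d)‖ < Λ

/-- **THE TD LEVEL** (socket lemma + windowed TD kill): for every `M`, `d`, `κ > 0` there is ONE level `Λ₁ = Λ₁(M, d, κ) > 0`
such that every `W ∈ 𝒦_M` with `‖W(−1, 0)‖ ≥ κ` has, at some `(t, y) ∈ (−2, −1) × B(0, 1)`, speed `≥ Λ₁` BOTH at `y` and at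
`y + √(−t)·d`. -/
theorem exists_translateLevel (M : ℝ) (d : E3) {κ : ℝ} (hκ : 0 < κ) :
    ∃ Λ₁ : ℝ, 0 < Λ₁ ∧ ∀ W : ℝ → E3 → E3, IsTypeIAncientMild M W → κ ≤ ‖W (-1) 0‖ →
      ∃ t ∈ Ioo (-2 : ℝ) (-1), ∃ y ∈ ball (0 : E3) 1,
        Λ₁ ≤ ‖W t y‖ ∧ Λ₁ ≤ ‖W t (y + Real.sqrt (-t) • d)‖ := by
  obtain ⟨Λ₁, hΛ₁, hno⟩ := exists_level_of_limitKill M hκ (TranslateDefectBelow d) (by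
    intro Wn W ε hεpos hεlim hWn hW hP hpt
    have hwin : ∀ t ∈ Ioo (-2 : ℝ) (-1), ∀ y ∈ ball (0 : E3) 1,
        W t y = 0 ∨ W t (y + Real.sqrt (-t) • d) = 0 := by
      intro t ht y hy
      have ht0 : t < 0 := by linarith [ht.2]
      have hm : Tendsto (fun n => min ‖Wn n t y‖ ‖Wn n t (y + Real.sqrt (-t) • d)‖) atTop
          (𝓝 (min ‖W t y‖ ‖W t (y + Real.sqrt (-t) • d)‖)) :=
        ((hpt t ht0 y).norm).min ((hpt t ht0 _).norm)
      have hle : min ‖W t y‖ ‖W t (y + Real.sqrt (-t) • d)‖ ≤ 0 := by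
        refine le_of_tendsto_of_tendsto hm hεlim (Eventually.of_forall fun n => ?_)
        rcases hP n t ht y hy with h1 | h2
        · exact (min_le_left _ _).trans h1.le
        · exact (min_le_right _ _).trans h2.le
      rcases le_total ‖W t y‖ ‖W t (y + Real.sqrt (-t) • d)‖ with hc | hc
      · left
        rw [min_eq_left hc] at hle
        exact norm_le_zero_iff.1 hle
      · right
        rw [min_eq_right hc] at hle
        exact norm_le_zero_iff.1 hle
    exact signal_eq_zero_of_translate_window hW (by norm_num : (-2 : ℝ) < -1) (by norm_num) one_pos
      (fun t => Real.sqrt (-t) • d) hwin (-1) (by norm_num))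
  refine ⟨Λ₁, hΛ₁, fun W hW hκW => ?_⟩
  have h := hno W hW hκW
  unfold TranslateDefectBelow at h
  push Not at h
  exact h

/-- General-point version of `eventually_fast_of_tendsto`. -/
theorem eventually_fast_of_tendsto' {T ν Λ₁ s : ℝ} {u : ℝ → E3 → E3} {c : ℕ → ℝ} {x : ℕ → E3} {y L : E3}
    (hcpos : ∀ j, 0 < c j) (hΛ : 0 < Λ₁)
    (hpt : Tendsto (fun j => (c j * 1) • u (T + c j ^ 2 * ν * s) (x j + (c j * ν) • y)) atTop (𝓝 L))
    (hL : Λ₁ ≤ ‖L‖) : ∀ᶠ j in atTop, Λ₁ / 2 < c j * ‖u (T + c j ^ 2 * ν * s) (x j + (c j * ν) • y)‖ := by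
  have hl := (hpt.norm).eventually_const_lt (show Λ₁ / 2 < ‖L‖ by linarith)
  filter_upwards [hl] with j hj
  rwa [mul_one, norm_smul, Real.norm_eq_abs, abs_of_pos (hcpos j)] at hj

/-- **Criterion row F1td is EXCLUDED** (in kernel): same three moves — TD level, normalised moving-centre zoom, pull-back of the
two fast points, which sit at the parabolic separation `√(ν(T − τ_j))·d`. -/
theorem rowF1td_holds : Row_F1td := by
  intro d M
  obtain ⟨Λ₁, hΛ₁, hkey⟩ := exists_translateLevel M d lerayLevel_pos
  refine ⟨Λ₁ / 4, by positivity, ?_⟩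
  intro ν T hν hT u p hsol hLH hdec hM hdisj
  by_contra hmax
  obtain ⟨c, x, W, hcpos, hclim, hW, hpt, hnorm⟩ :=
    exists_normalisedZoom_package hν hT hsol hLH hdec hM hmax
  obtain ⟨t, ht, y, hy, h1, h2⟩ := hkey W hW hnorm
  have ht0 : t < 0 := by linarith [ht.2]
  have ht1 : t ≤ -1 := ht.2.le
  set y' : E3 := y + Real.sqrt (-t) • d with hy'
  have hev1 : ∀ᶠ j in atTop, Λ₁ / 2 < c j * ‖u (T + c j ^ 2 * ν * t) (x j + (c j * ν) • y)‖ :=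
    eventually_fast_of_tendsto' hcpos hΛ₁ (hpt t ht0 y) h1
  have hev2 : ∀ᶠ j in atTop, Λ₁ / 2 < c j * ‖u (T + c j ^ 2 * ν * t) (x j + (c j * ν) • y')‖ :=
    eventually_fast_of_tendsto' hcpos hΛ₁ (hpt t ht0 y') h2
  have hτ : Tendsto (fun j => T + c j ^ 2 * ν * t) atTop (𝓝[<] T) := ColumnarTop.tendsto_physicalTime hν ht0 hcpos hclim
  have hev3 := hτ.eventually hdisj
  obtain ⟨j, hj1, hj2, hj3⟩ := (hev1.and (hev2.and hev3)).exists
  have hm1 : x j + (c j * ν) • y ∈ TwoTimeTop.topSet ν T u (Λ₁ / 4) (T + c j ^ 2 * ν * t) :=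
    mem_topSet_of_zoom hν (hcpos j) hΛ₁ ht1 hj1
  have hm2 : x j + (c j * ν) • y' ∈ TwoTimeTop.topSet ν T u (Λ₁ / 4) (T + c j ^ 2 * ν * t) :=
    mem_topSet_of_zoom hν (hcpos j) hΛ₁ ht1 hj2
  -- the two physical points are at the parabolic separation `√(ν(T − τ_j))·d`
  have hsep : x j + (c j * ν) • y' =
      (x j + (c j * ν) • y) + Real.sqrt (ν * (T - (T + c j ^ 2 * ν * t))) • d := by
    have e : ν * (T - (T + c j ^ 2 * ν * t)) = (c j * ν) ^ 2 * (-t) := by ring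
    rw [e, Real.sqrt_mul (sq_nonneg _), Real.sqrt_sq (mul_pos (hcpos j) hν).le, hy', smul_add,
      smul_smul, add_assoc]
  rw [hsep] at hm2
  exact hj3 _ hm1 hm2

/-! ## §7 Sharpness and order remarks (in kernel where cheap) -/

/-- One-level disjointness is MONOTONE in the level: disjoint tops of level `Λ` are disjoint at every higher level. -/
theorem hasDisjointTopsAt_mono {ν T θ Λ Λ' : ℝ} {u : ℝ → E3 → E3} (hle : Λ ≤ Λ')
    (h : HasDisjointTopsAt ν T θ Λ u) : HasDisjointTopsAt ν T θ Λ' u := by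
  have hν : 0 ≤ Real.sqrt ν := Real.sqrt_nonneg ν
  filter_upwards [h] with t ht
  exact Set.disjoint_left.2 fun x hx1 hx2 =>
    Set.disjoint_left.1 ht (TwoTimeTop.mem_topSet_of_le hν hle hx1) (TwoTimeTop.mem_topSet_of_le hν hle hx2)

/-- Hence the all-levels hypothesis of LINE 34 is the conjunction over levels of the one-level hypotheses, and the one-level
row at `Λ₀` covers every level `Λ ≤ Λ₀` at once. -/
theorem hasDisjointTops_iff {ν T θ : ℝ} {u : ℝ → E3 → E3} :
    TwoTimeTop.HasDisjointTops ν T θ u ↔ ∀ Λ : ℝ, 0 < Λ → HasDisjointTopsAt ν T θ Λ u := Iff.rfl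

/-- **Summary of LINE 35.** -/
theorem oneLevelTop_summary :
    Row_F1lv ∧ TwoTimeTop.Row_F1dj ∧ OneLevelFloor ∧ (LevelCollapse ↔ ScenarioCensus.Row_F1) ∧ Row_F1td :=
  ⟨rowF1lv_holds, TwoTimeTop.rowF1dj_holds, oneLevelFloor_holds, levelCollapse_iff_rowF1, rowF1td_holds⟩

end Summit.NavierStokesRegularity.NavierStokesRegularity.Theorems.ScenarioCensus.OneLevelTop

namespace Summit.NavierStokesRegularity.NavierStokesRegularity.Theorems.ScenarioCensus

/-! ## Census KEYS (ns `…Theorems.ScenarioCensus`): the ONE-LEVEL members of row F1 (LINE 35) — TREE-decided F1lv / F1td and floor OLF -/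

/-- **Cell F1lv** (ONE-LEVEL DISJOINT TOPS: Type I with dimensionless constant `M` · disjoint tops of ONE level `Λ₀(M, θ)` chosen before the solution · Clay ⇒ smooth extension past `T`): `:= OneLevelTop.Row_F1lv`. DECIDED. -/
def Row_F1lv : Prop := OneLevelTop.Row_F1lv
/-- F1lv is EXCLUDED (decided in the tree): `OneLevelTop.rowF1lv_holds`. -/
theorem row_F1lv_excluded : Row_F1lv := OneLevelTop.rowF1lv_holds

/-- **Cell F1td** (ONE-LEVEL TRANSLATE-DISJOINT TOPS: eventually no two `Λ₀`-fast points at separation `√(ν(T−t))·d`): `:= OneLevelTop.Row_F1td`. DECIDED. -/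
def Row_F1td : Prop := OneLevelTop.Row_F1td
/-- F1td is EXCLUDED (decided in the tree): `OneLevelTop.rowF1td_holds`. -/
theorem row_F1td_excluded : Row_F1td := OneLevelTop.rowF1td_holds

/-- **Floor OLF — ONE-LEVEL FLOOR** (persistent fast points at a DEFINITE level): `OneLevelTop.oneLevelFloor_holds`. -/
theorem row_F1_oneLevelFloor : OneLevelTop.OneLevelFloor := OneLevelTop.oneLevelFloor_holds
/-- Order edge at key level: F1lv ⇒ F1dj (`OneLevelTop.rowF1dj_of_rowF1lv`). -/
theorem rowF1dj_of_rowF1lv : Row_F1lv → Row_F1dj := OneLevelTop.rowF1dj_of_rowF1lv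

end Summit.NavierStokesRegularity.NavierStokesRegularity.Theorems.ScenarioCensus

end
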